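/-
Copyright (c) 2026 the pub-hodgecm-mathlib formalisation cell (harness21).  Prover seat hodgecm-mathlib-K2Liu-p01 (g8), Track B «K2-LIT»,
#184♮ = hLiu418 = `stmt-HodgeConjecture-24832`; #42S organ S1 ROAD W, witness TOP FILE part (W1-d) (RECIPE-F7-InertWitnessTopFile 80571dd96a2cf31d §B):
the lattice-pair witnesses `ΓΦ_ε = 𝟙_{κ⁻¹S₁²} − 𝟙_{κ⁻¹S₂²}` ARE Schwartz–Bruhat and supported in `κ⁻¹S₁²`, for any additive HOMEOMORPHISM `κ` (★ p08 `exists_frame_homeomorph` p860530 +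
★ (K3) p860389) and compact open boxes `S₂² ⊆ S₁²` (★ (B) ∕ E-det).
-/
import Literature.RepresentationTheory.HeisenbergGroup.SchwartzBruhatDualFamily   -- ★ `indicator_mem_schwartzBruhat_of_isCompact_isOpen`
import HarnessLib

/-!
# Crux `HLiu418`, #42S-S1 ROAD W, (W1-d): THE LATTICE-PAIR WITNESS IS SCHWARTZ–BRUHAT, SUPPORTED IN THE PULLED-BACK BOX

Cell `hodgecm-mathlib`, crux item hLiu418 = `stmt-HodgeConjecture-24832` (helper lane `--supports … --as helper`, count-neutral).  THEOREMS ONLY (no `def`, no instance,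
no notation, no named-fact hypothesis, no `sorry`).  GENERIC (topological spaces, an equivalence `κ` continuous both ways; Mathlib + ★ `SchwartzBruhatDualFamily`).

WHY (RECIPE §B «Φ_ε := Γ_ε⁻¹(𝟙_{κ⁻¹S₁²} − 𝟙_{κ⁻¹S₂²})»).  ★ F4b's implementer `Γ : LocalWeilModel ≃ₗ 𝒮(Y)` needs the witness profile `g_ε` IN `𝒮(Y)`; ★ (W1-a)'s `hsupp` needs `g_ε = 0` off
`K := κ⁻¹S₁²`; ★ (J)'s `hP` reads `g_ε` as `𝟙_{A₁} − 𝟙_{A₂}`.  With `κ` a homeomorphism (★ p08 p860530 `exists_frame_homeomorph` fed by ★ (K3) p860389) and `S_i²` compact open: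
* `isCompact_preimage_equiv`, `isOpen_preimage_equiv` — pulled-back boxes are compact open;
* **`indicator_preimage_mem_schwartzBruhat`** — `𝟙_{κ⁻¹W} ∈ 𝒮`;  **`witness_mem_schwartzBruhat`** — `𝟙_{κ⁻¹W₁} − 𝟙_{κ⁻¹W₂} ∈ 𝒮`;
* **`witness_eq_zero_of_not_mem`** — it vanishes off `κ⁻¹W₁` (`W₂ ⊆ W₁`): ★ (W1-a)'s `hsupp`;  `witness_apply_zero_of_mem` — it vanishes AT points of `κ⁻¹W₂` (e.g. `0`: the closed-cell
  value `ΓΦ(0) = 0` of `hf₀off`);  `witness_eq_indicator_diff` — `= 𝟙_{κ⁻¹(W₁∖W₂)}`.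
[BernsteinZelevinsky1976, §1.2] [WeilBNT1967, Chap. VII §2] [Kudla1994, §3].
HONEST LABEL.  Count-neutral helper; `HC_CM` is proved only modulo the 7 printed citations (2 remaining named inputs: hLiu418 = `stmt-HodgeConjecture-24832`,
h413 = `stmt-HodgeConjecture-24833`) until rung 0 closes.

## References
* [BernsteinZelevinsky1976] I. N. Bernstein, A. V. Zelevinsky, Russian Math. Surveys 31 (1976), §1.2.
* [WeilBNT1967] A. Weil, *Basic Number Theory* (1967), Chap. VII §2.
* [Kudla1994] S. S. Kudla, Israel J. Math. 87 (1994), §3.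
-/

set_option autoImplicit false
set_option linter.dupNamespace false -- the mandated namespace repeats `HodgeConjecture.HodgeConjecture`

noncomputable section

open Literature.RepresentationTheory.HeisenbergGroup Literature.NumberTheory.Automorphic

namespace Summit.HodgeConjecture.HodgeConjecture.Cruxes.HLiu418.K2LiuWitnessSchwartzBruhat

variable {X Y : Type*} [TopologicalSpace X] [TopologicalSpace Y]

/-- preimage under a bicontinuous equivalence of a COMPACT set is compact (`κ⁻¹W = κ⁻¹(W)` is the image under `κ⁻¹`). [folklore] -/
theorem isCompact_preimage_equiv (κ : X ≃ Y) (hκ' : Continuous κ.symm) {W : Set Y} (hW : IsCompact W) : IsCompact (κ ⁻¹' W) := by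
  rw [← κ.image_symm_eq_preimage]
  exact hW.image hκ'

/-- preimage under a continuous map of an OPEN set is open. [folklore] -/
theorem isOpen_preimage_equiv (κ : X ≃ Y) (hκ : Continuous κ) {W : Set Y} (hW : IsOpen W) : IsOpen (κ ⁻¹' W) :=
  hW.preimage hκ

/-- **`𝟙_{κ⁻¹W} ∈ 𝒮(X)`** for a bicontinuous `κ` and compact open `W` (Hausdorff `X`). [cite: BernsteinZelevinsky1976, §1.2] [cite: WeilBNT1967, Chap. VII §2] -/
theorem indicator_preimage_mem_schwartzBruhat [T2Space X] (κ : X ≃ Y) (hκ : Continuous κ) (hκ' : Continuous κ.symm) {W : Set Y} (hWc : IsCompact W) (hWo : IsOpen W)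
    (c : ℂ) : ((κ ⁻¹' W).indicator fun _ => c) ∈ SchwartzBruhat X :=
  indicator_mem_schwartzBruhat_of_isCompact_isOpen (isCompact_preimage_equiv κ hκ' hWc) (isOpen_preimage_equiv κ hκ hWo) c

/-- **THE LATTICE-PAIR WITNESS IS SCHWARTZ–BRUHAT**: `𝟙_{κ⁻¹W₁} − 𝟙_{κ⁻¹W₂} ∈ 𝒮(X)`. [cite: Kudla1994, §3] [cite: BernsteinZelevinsky1976, §1.2] -/
theorem witness_mem_schwartzBruhat [T2Space X] (κ : X ≃ Y) (hκ : Continuous κ) (hκ' : Continuous κ.symm) {W₁ W₂ : Set Y} (h₁c : IsCompact W₁) (h₁o : IsOpen W₁)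
    (h₂c : IsCompact W₂) (h₂o : IsOpen W₂) :
    (((κ ⁻¹' W₁).indicator fun _ => (1 : ℂ)) - (κ ⁻¹' W₂).indicator fun _ => (1 : ℂ)) ∈ SchwartzBruhat X :=
  (SchwartzBruhat X).sub_mem (indicator_preimage_mem_schwartzBruhat κ hκ hκ' h₁c h₁o 1) (indicator_preimage_mem_schwartzBruhat κ hκ hκ' h₂c h₂o 1)

omit [TopologicalSpace X] [TopologicalSpace Y] in
/-- **SUPPORT**: for `W₂ ⊆ W₁` the witness vanishes off `κ⁻¹W₁` (★ (W1-a)'s `hsupp` with `K := κ⁻¹W₁`). [cite: Kudla1994, §3] -/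
theorem witness_eq_zero_of_not_mem (κ : X → Y) {W₁ W₂ : Set Y} (h : W₂ ⊆ W₁) :
    ∀ x ∉ κ ⁻¹' W₁, (((κ ⁻¹' W₁).indicator fun _ => (1 : ℂ)) - (κ ⁻¹' W₂).indicator fun _ => (1 : ℂ)) x = 0 := by
  intro x hx
  have hx2 : x ∉ κ ⁻¹' W₂ := fun h2 => hx (h h2)
  rw [Pi.sub_apply, Set.indicator_of_notMem hx, Set.indicator_of_notMem hx2, sub_zero]

omit [TopologicalSpace X] [TopologicalSpace Y] in
/-- the witness vanishes at points of the SMALL box `κ⁻¹W₂` (e.g. at `0`: the closed-cell value `ΓΦ(0) = 0`). [cite: Kudla1994, §3] -/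
theorem witness_apply_zero_of_mem (κ : X → Y) {W₁ W₂ : Set Y} (h : W₂ ⊆ W₁) {x : X} (hx : x ∈ κ ⁻¹' W₂) :
    (((κ ⁻¹' W₁).indicator fun _ => (1 : ℂ)) - (κ ⁻¹' W₂).indicator fun _ => (1 : ℂ)) x = 0 := by
  rw [Pi.sub_apply, Set.indicator_of_mem (show x ∈ κ ⁻¹' W₁ from h hx), Set.indicator_of_mem hx, sub_self]

omit [TopologicalSpace X] [TopologicalSpace Y] in
/-- the witness IS the indicator of the shell `κ⁻¹(W₁ ∖ W₂)` (for `W₂ ⊆ W₁`). [folklore] -/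
theorem witness_eq_indicator_diff (κ : X → Y) {W₁ W₂ : Set Y} (h : W₂ ⊆ W₁) :
    (((κ ⁻¹' W₁).indicator fun _ => (1 : ℂ)) - (κ ⁻¹' W₂).indicator fun _ => (1 : ℂ)) = (κ ⁻¹' (W₁ \ W₂)).indicator fun _ => (1 : ℂ) := by
  funext x
  by_cases h2 : x ∈ κ ⁻¹' W₂
  · rw [witness_apply_zero_of_mem κ h h2, Set.indicator_of_notMem]
    exact fun hx => hx.2 h2
  · by_cases h1 : x ∈ κ ⁻¹' W₁
    · rw [Pi.sub_apply, Set.indicator_of_mem h1, Set.indicator_of_notMem h2, sub_zero, Set.indicator_of_mem (show x ∈ κ ⁻¹' (W₁ \ W₂) from ⟨h1, h2⟩)]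
    · rw [witness_eq_zero_of_not_mem κ h x h1, Set.indicator_of_notMem]
      exact fun hx => h1 hx.1

end Summit.HodgeConjecture.HodgeConjecture.Cruxes.HLiu418.K2LiuWitnessSchwartzBruhat

end
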